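import Literature.Analysis.Fourier.PaleyWienerDeformation
import HarnessLib

/-!
# Paley–Wiener by complex deformation for AFFINE matrix pencils: finite propagation for the
multipliers `exp(E + L·)(D)`

`PaleyWienerDeformation.lean` proves the support theorem for multiplier operators
`exp(L·)(D)ψ = 𝓕⁻¹[exp(Lξ) 𝓕ψ(ξ)]` whose symbol is the exponential of a real-LINEAR matrix pencil
`L : V →L[ℝ] Matrix (Fin k) (Fin k) ℂ` of exponential type (`HasExpType`). The solution operator at
time `t` of a constant-coefficient first-order system WITH a zeroth-order term,
`A₀∂ₜu + Σ Aⱼ∂ⱼu + B₁u = 0`, has the symbol `exp(t(L₁ξ + E))` — the exponential of an AFFINE pencil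
(`Literature.Barriers.AtomisticToContinuum.rauchSymbol A₀ A B₁ t`, [Rauch1986, (4) p. 482 and Proof
of Theorem p. 483: `M(ξ) = exp(t̄A₀⁻¹(-Σ A_l iξ_l - B′(ū)))`]) — and the constant term `E` does not
scale away. This file runs the deformation argument of `PaleyWienerDeformation.lean` (Part C there)
for affine pencils `ξ ↦ E + Lξ`:

* `symMA E L ν b ξ = exp(E + Lξ + (ib)Lν)`, `symDA` its complex derivative along `w ↦ E + Lξ + wLν`;
* `HasExpTypeA E L C γ` — the exponential-type hypothesis, now required for the whole segment of
  constant terms `θE`, `0 ≤ θ ≤ 1`: `|exp(θE + Lξ + (ib)Lν)ᵢⱼ| ≤ C e^{γ|b|}`. The segment is what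
  Duhamel's formula for the derivative bound consumes (`HasExpTypeA.norm_symDA_le`: the scalings
  `θ(E + Lξ + (ib)Lν + sLν) = θE + L(θ(ξ + sν)) + i(θb)Lν`, `smul_line_eq_affine`); for the symbols
  of hyperbolic systems it costs nothing, the bound of [Brenner1973, (0.3) p. 75] being monotone in
  the size of the zeroth-order term;
* `multiplierOp_expAffine_apply_eq_zero`, `multiplierOp_expAffine_apply_eq_zero_of_dist` — if
  `HasExpTypeA E L C γ` and `ψ ∈ C_c^∞(V; ℂᵏ)` is supported in `B̄(x₀, r)`, then
  `exp(E + L·)(D)ψ (x) = 0` for `‖x - x₀‖ > r + γ/(2π)`.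

The proof is verbatim that of `PaleyWienerDeformation.lean` (the Cauchy–Riemann relation in the
deformation parameter, differentiation under the integral sign, integration by parts in the
frequency, and the exponential decay of the deformed integral), with `Lξ` replaced by `E + Lξ`; all
the tools of Parts A and B of that file (holomorphy of `w ↦ exp(X + wY)`, Duhamel, the deformed test
functions `ψ_b` and the decay of `𝓕ψ_b`, the phase `phaseE`, the majorants `fourierMajorant`,
`phiMajorant`) are reused as they stand. The case `E = 0` is the linear theorem
(`symMA_zero_left`). Consumer: finite speed of propagation for constant-coefficient systems in
Rauch's class WITH zeroth-order term
(`Literature/Barriers/AtomisticToContinuum/NoBVEstimatesMultiDFinitePropagationZeroth.lean`), hence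
Rauch's linear step `Rauch1986_linearL1EstimateForcesCommutation` in full.

## References

* [Rauch1986] J. Rauch, *BV estimates fail for most quasilinear hyperbolic systems in dimensions
  greater than one*, Comm. Math. Phys. 106 (1986) 481–484: (4) p. 482, Proof of Theorem
  pp. 482–483 ("the finite speed of propagation for (1)"; the multiplier `M(ξ)` with `B′(ū)`).
* [HormanderALPDO2] L. Hörmander, *The Analysis of Linear Partial Differential Operators II*,
  Thm 12.5.1 (support of the fundamental solution of a hyperbolic operator by shifting the contour
  of the inverse Fourier integral; the lower-order terms are carried along).
* [Brenner1973] P. Brenner, Ark. Mat. 11 (1973) 75–101, (0.3) p. 75.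
-/

noncomputable section

open Set Filter Topology MeasureTheory Real Metric Complex Matrix
open scoped FourierTransform RealInnerProductSpace ContDiff Matrix.Norms.Operator

namespace Literature.Analysis.Fourier

variable {V : Type*} [NormedAddCommGroup V] [InnerProductSpace ℝ V] [FiniteDimensional ℝ V]
  [MeasurableSpace V] [BorelSpace V] {k : ℕ}

local notation "𝕄" => Matrix (Fin k) (Fin k) ℂ

/-! ### The deformed affine symbol `M_b(ξ) = exp(E + Lξ + (bi) Lν)` -/

/-- The deformed affine symbol `M_b(ξ) = exp(E + Lξ + (ib) Lν)` ("the symbol `exp(E + L·)` at the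
complex frequency `ξ + ibν`"). [cite: Rauch1986, Proof of Theorem p. 483] -/
def symMA (E : 𝕄) (L : V →L[ℝ] 𝕄) (ν : V) (b : ℝ) (ξ : V) : 𝕄 :=
  NormedSpace.exp (E + L ξ + ((b : ℂ) * I) • L ν)

/-- Its complex derivative along the line `w ↦ E + Lξ + w Lν` at `w = ib`. [folklore] -/
def symDA (E : 𝕄) (L : V →L[ℝ] 𝕄) (ν : V) (b : ℝ) (ξ : V) : 𝕄 :=
  deriv (fun w : ℂ => NormedSpace.exp (E + L ξ + w • L ν)) ((b : ℂ) * I)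

omit [FiniteDimensional ℝ V] [MeasurableSpace V] [BorelSpace V] in
/-- `M_0(ξ) = exp(E + Lξ)`. [folklore] -/
theorem symMA_zero_right (E : 𝕄) (L : V →L[ℝ] 𝕄) (ν ξ : V) :
    symMA E L ν 0 ξ = NormedSpace.exp (E + L ξ) := by
  simp [symMA]

omit [FiniteDimensional ℝ V] [MeasurableSpace V] [BorelSpace V] in
/-- Without constant term the affine symbol is the linear one: `symMA 0 L = symM L`. [folklore] -/
theorem symMA_zero_left (L : V →L[ℝ] 𝕄) (ν : V) (b : ℝ) (ξ : V) :
    symMA 0 L ν b ξ = symM L ν b ξ := by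
  rw [symMA, symM, zero_add]

omit [FiniteDimensional ℝ V] [MeasurableSpace V] [BorelSpace V] in
/-- `∂_b M_b(ξ) = i M'_b(ξ)`. [folklore] -/
theorem hasDerivAt_symMA_param (E : 𝕄) (L : V →L[ℝ] 𝕄) (ν ξ : V) (b : ℝ) :
    HasDerivAt (fun b : ℝ => symMA E L ν b ξ) (I • symDA E L ν b ξ) b := by
  have h := hasDerivAt_exp_add_smul_imag (E + L ξ) (L ν) 0 b
  simp only [zero_add] at h
  exact h

omit [FiniteDimensional ℝ V] [MeasurableSpace V] [BorelSpace V] in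
/-- `E + L(ξ + sν) + (ib)Lν = E + Lξ + (ib + s)Lν`. [folklore] -/
theorem map_add_smul_add_affine (E : 𝕄) (L : V →L[ℝ] 𝕄) (ν ξ : V) (b s : ℝ) :
    E + L (ξ + s • ν) + ((b : ℂ) * I) • L ν = E + L ξ + ((b : ℂ) * I + (s : ℂ)) • L ν := by
  rw [map_add, map_smul, add_smul, ← Complex.coe_smul]
  abel

omit [FiniteDimensional ℝ V] [MeasurableSpace V] [BorelSpace V] in
/-- `∂_s M_b(ξ + sν)|₀ = M'_b(ξ)`. [folklore] -/
theorem hasDerivAt_symMA_line (E : 𝕄) (L : V →L[ℝ] 𝕄) (ν ξ : V) (b : ℝ) :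
    HasDerivAt (fun s : ℝ => symMA E L ν b (ξ + s • ν)) (symDA E L ν b ξ) 0 := by
  have h := hasDerivAt_exp_add_smul_real (E + L ξ) (L ν) ((b : ℂ) * I) 0
  simp only [Complex.ofReal_zero, add_zero] at h
  have hfun : (fun s : ℝ => symMA E L ν b (ξ + s • ν)) =
      fun s : ℝ => NormedSpace.exp (E + L ξ + ((b : ℂ) * I + (s : ℂ)) • L ν) := by
    funext s
    rw [symMA, map_add_smul_add_affine]
  rw [hfun]
  exact h

/-! ### Bounds for the deformed symbol from the exponential-type hypothesis -/

/-- **Exponential type of the deformed affine symbols, uniformly along the segment of constant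
terms `θE`, `0 ≤ θ ≤ 1`**: entrywise `|exp(θE + Lξ + (ib)Lν)ᵢⱼ| ≤ C e^{γ|b|}` for all frequencies
`ξ`, unit directions `ν`, real `b` and `θ ∈ [0, 1]` (the segment is consumed by Duhamel's formula
in `HasExpTypeA.norm_symDA_le`). [folklore] -/
def HasExpTypeA (E : 𝕄) (L : V →L[ℝ] 𝕄) (C γ : ℝ) : Prop :=
  ∀ θ ∈ Icc (0 : ℝ) 1, ∀ (ξ ν : V) (b : ℝ), ‖ν‖ ≤ 1 → ∀ i j,
    ‖symMA (((θ : ℝ) : ℂ) • E) L ν b ξ i j‖ ≤ C * Real.exp (γ * |b|)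

omit [FiniteDimensional ℝ V] [MeasurableSpace V] [BorelSpace V] in
/-- The linear exponential type is the affine one without constant term. [folklore] -/
theorem HasExpType.hasExpTypeA_zero {L : V →L[ℝ] 𝕄} {C γ : ℝ} (h : HasExpType L C γ) :
    HasExpTypeA 0 L C γ := by
  intro θ _ ξ ν b hν i j
  rw [smul_zero, symMA_zero_left]
  exact h ξ ν b hν i j

omit [FiniteDimensional ℝ V] [MeasurableSpace V] [BorelSpace V] in
/-- Operator norm of the deformed symbol along the segment: `‖exp(θE + Lξ +
  (ib)Lν)‖ ≤ k C e^{γ|b|}`.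
[folklore] -/
theorem HasExpTypeA.norm_symMA_smul_le {E : 𝕄} {L : V →L[ℝ] 𝕄} {C γ : ℝ} (h : HasExpTypeA E L C γ)
    (hC : 0 ≤ C) {ν : V} (hν : ‖ν‖ ≤ 1) (b : ℝ) (ξ : V) {θ : ℝ} (hθ : θ ∈ Icc (0 : ℝ) 1) :
    ‖symMA (((θ : ℝ) : ℂ) • E) L ν b ξ‖ ≤ k * (C * Real.exp (γ * |b|)) :=
  linfty_opNorm_le_of_entry_le (by positivity) (h θ hθ ξ ν b hν)

omit [FiniteDimensional ℝ V] [MeasurableSpace V] [BorelSpace V] in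
/-- Operator norm of the deformed symbol: `‖M_b(ξ)‖ ≤ k C e^{γ|b|}` (`θ = 1`). [folklore] -/
theorem HasExpTypeA.norm_symMA_le {E : 𝕄} {L : V →L[ℝ] 𝕄} {C γ : ℝ} (h : HasExpTypeA E L C γ)
    (hC : 0 ≤ C) {ν : V} (hν : ‖ν‖ ≤ 1) (b : ℝ) (ξ : V) :
    ‖symMA E L ν b ξ‖ ≤ k * (C * Real.exp (γ * |b|)) := by
  have h1 := h.norm_symMA_smul_le hC hν b ξ (θ := 1) ⟨zero_le_one, le_rfl⟩
  rwa [Complex.ofReal_one, one_smul] at h1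

omit [FiniteDimensional ℝ V] [MeasurableSpace V] [BorelSpace V] in
/-- The deformation family is closed under the scalings of Duhamel's formula, the constant term
moving along its segment: `θ (E + Lξ + (ib)Lν + s Lν) = θE + L(θ(ξ + sν)) + (iθb) Lν`. [folklore] -/
theorem smul_line_eq_affine (E : 𝕄) (L : V →L[ℝ] 𝕄) (ν ξ : V) (b s θ : ℝ) :
    θ • (E + L ξ + ((b : ℂ) * I) • L ν + (s : ℂ) • L ν) =
      ((θ : ℝ) : ℂ) • E + L (θ • (ξ + s • ν)) + (((θ * b : ℝ) : ℂ) * I) • L ν := by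
  rw [map_smul, map_add, map_smul]
  ext i j
  simp only [Matrix.smul_apply, Matrix.add_apply, smul_eq_mul, Complex.real_smul]
  push_cast
  ring

omit [FiniteDimensional ℝ V] [MeasurableSpace V] [BorelSpace V] in
/-- **Bound for the line derivative**: `‖M'_b(ξ)‖ ≤ (k C e^{γ(|b|+1)})² ‖Lν‖` (Duhamel, the
exponentials of the scaled exponents being deformed affine symbols with constant terms `θE`).
[folklore] -/
theorem HasExpTypeA.norm_symDA_le {E : 𝕄} {L : V →L[ℝ] 𝕄} {C γ : ℝ} (h : HasExpTypeA E L C γ)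
    (hC : 0 ≤ C) (hγ : 0 ≤ γ) {ν : V} (hν : ‖ν‖ ≤ 1) (b : ℝ) (ξ : V) :
    ‖symDA E L ν b ξ‖ ≤ (k * (C * Real.exp (γ * (|b| + 1)))) ^ 2 * ‖L ν‖ := by
  -- translate the base point to `0`
  have htrans : symDA E L ν b ξ =
      deriv (fun w : ℂ => NormedSpace.exp ((E + L ξ + ((b : ℂ) * I) • L ν) + w • L ν)) 0 := by
    rw [symDA]
    have := deriv_comp_const_add (f := fun w : ℂ => NormedSpace.exp (E + L ξ + w • L ν))
      ((b : ℂ) * I) 0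
    rw [add_zero] at this
    refine this.symm.trans ?_
    congr 1
    funext w
    congr 1
    rw [add_smul]
    abel
  rw [htrans]
  refine norm_deriv_exp_add_smul_le _ _ (by positivity) fun θ hθ s hs => ?_
  rw [smul_line_eq_affine]
  -- this is `symMA (θE) L ν (θ b) (θ(ξ + sν))`
  have := h.norm_symMA_smul_le hC hν (θ * b) (θ • (ξ + s • ν)) hθ
  refine (le_of_eq (by rfl)).trans (this.trans ?_)
  refine mul_le_mul_of_nonneg_left (mul_le_mul_of_nonneg_left (Real.exp_le_exp.2 ?_) hC)
    (Nat.cast_nonneg k)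
  refine mul_le_mul_of_nonneg_left ?_ hγ
  rw [abs_mul, abs_of_nonneg hθ.1]
  calc θ * |b| ≤ 1 * |b| := mul_le_mul_of_nonneg_right hθ.2 (abs_nonneg b)
    _ ≤ |b| + 1 := by linarith

/-! ### The deformed integrand `Φ_b(ξ) = E_b(ξ) M_b(ξ) 𝓕ψ_b(ξ)` -/

/-- `Φ_b(ξ) = E_b(ξ) • (M_b(ξ) 𝓕ψ_b(ξ))`. [folklore] -/
def defPhiA (E : 𝕄) (L : V →L[ℝ] 𝕄) (ψ : V → Fin k → ℂ) (x ν : V) (b : ℝ) (ξ : V) : Fin k → ℂ :=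
  phaseE x ν b ξ • (symMA E L ν b ξ *ᵥ 𝓕 (deform ψ ν b) ξ)

/-- The `b`-derivative of `Φ_b(ξ)`. [folklore] -/
def defPhiDbA (E : 𝕄) (L : V →L[ℝ] 𝕄) (ψ : V → Fin k → ℂ) (x ν : V) (b : ℝ) (ξ : V) : Fin k → ℂ :=
  ((-(2 * π * ⟪x, ν⟫) : ℂ) * phaseE x ν b ξ) • (symMA E L ν b ξ *ᵥ 𝓕 (deform ψ ν b) ξ) +
    phaseE x ν b ξ • ((I • symDA E L ν b ξ) *ᵥ 𝓕 (deform ψ ν b) ξ +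
      symMA E L ν b ξ *ᵥ 𝓕 (deform (innerWeight ψ ν) ν b) ξ)

/-- The line derivative of `Φ_b` along `ν`. [folklore] -/
def defPhiDνA (E : 𝕄) (L : V →L[ℝ] 𝕄) (ψ : V → Fin k → ℂ) (x ν : V) (b : ℝ) (ξ : V) : Fin k → ℂ :=
  ((2 * π * I * ⟪ν, x⟫) * phaseE x ν b ξ) • (symMA E L ν b ξ *ᵥ 𝓕 (deform ψ ν b) ξ) +
    phaseE x ν b ξ • (symDA E L ν b ξ *ᵥ 𝓕 (deform ψ ν b) ξ +
      symMA E L ν b ξ *ᵥ 𝓕 (fun v => (-(2 * π * I * ⟪v, ν⟫)) • deform ψ ν b v) ξ)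

omit [FiniteDimensional ℝ V] [MeasurableSpace V] [BorelSpace V] in
/-- At `b = 0` the integrand is the inverse-Fourier integrand of `exp(E + L·)(D)ψ` at `x`.
[folklore] -/
theorem defPhiA_zero [MeasurableSpace V] [BorelSpace V] [FiniteDimensional ℝ V]
    (E : 𝕄) (L : V →L[ℝ] 𝕄) (ψ : V → Fin k → ℂ) (x ν ξ : V) :
    defPhiA E L ψ x ν 0 ξ =
      Complex.exp (((2 * π * ⟪ξ, x⟫ : ℝ) : ℂ) * I) • (NormedSpace.exp (E + L ξ) *ᵥ 𝓕 ψ ξ) := by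
  rw [defPhiA, phaseE_zero, symMA_zero_right, deform_zero]

/-- **`∂_b Φ_b(ξ)`**. [folklore] -/
theorem hasDerivAt_defPhiA_param (E : 𝕄) (L : V →L[ℝ] 𝕄) {ψ : V → Fin k → ℂ} (hψ : ContDiff ℝ ∞ ψ)
    (hc : HasCompactSupport ψ) (x ν ξ : V) (b : ℝ) :
    HasDerivAt (fun b : ℝ => defPhiA E L ψ x ν b ξ) (defPhiDbA E L ψ x ν b ξ) b := by
  have h := hasDerivAt_smul_mulVec (hasDerivAt_phaseE_param x ν ξ b)
    (hasDerivAt_symMA_param E L ν ξ b) (hasDerivAt_fourier_deform_param hψ hc ν ξ b)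
  exact h

/-- **`∂_ν Φ_b(ξ)`** (a line derivative). [folklore] -/
theorem hasLineDerivAt_defPhiA (E : 𝕄) (L : V →L[ℝ] 𝕄) {ψ : V → Fin k → ℂ} (hψ : ContDiff ℝ ∞ ψ)
    (hc : HasCompactSupport ψ) (x ν ξ : V) (b : ℝ) :
    HasLineDerivAt ℝ (defPhiA E L ψ x ν b) (defPhiDνA E L ψ x ν b ξ) ξ ν := by
  have h := hasDerivAt_smul_mulVec (hasDerivAt_phaseE_line x ν ξ b)
    (hasDerivAt_symMA_line E L ν ξ b)
    (hasDerivAt_fourier_line ((contDiff_deform (n := ∞) hψ ν b).continuous)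
      (hasCompactSupport_deform hc ν b) ξ ν)
  simp only [zero_smul, add_zero] at h
  exact h

/-- **Cauchy–Riemann for the integrand**: `∂_b Φ_b(ξ) = i ∂_ν Φ_b(ξ)`. [folklore] -/
theorem defPhiDbA_eq (E : 𝕄) (L : V →L[ℝ] 𝕄) (ψ : V → Fin k → ℂ) (x ν ξ : V) (b : ℝ) :
    defPhiDbA E L ψ x ν b ξ = I • defPhiDνA E L ψ x ν b ξ := by
  rw [defPhiDbA, defPhiDνA, fourier_deform_innerWeight_eq, phaseE_cr, Matrix.smul_mulVec,
    Matrix.mulVec_smul, smul_add, smul_add, mul_smul, smul_comm (phaseE x ν b ξ) I,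
    smul_comm (phaseE x ν b ξ) I, smul_add, smul_add]

/-! ### Majorants -/

section Majorant

set_option maxHeartbeats 1000000 in
/-- **The three bounds.** For `|b| ≤ β` the integrand `Φ_b`, its `b`-derivative and its line
derivative along `ν` are all bounded by `K_β (1 + ‖ξ‖^D)⁻¹`. [folklore] -/
theorem norm_defPhiA_le {E : 𝕄} {L : V →L[ℝ] 𝕄} {C γ : ℝ} (hT : HasExpTypeA E L C γ) (hC : 0 ≤ C)
    (hγ : 0 ≤ γ)
    {ψ : V → Fin k → ℂ} (hψ : ContDiff ℝ ∞ ψ) (hc : HasCompactSupport ψ) {ρ : ℝ} (hρ : 0 ≤ ρ)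
    (hsupp : tsupport ψ ⊆ closedBall (0 : V) ρ) {x ν : V} (hν : ‖ν‖ ≤ 1) {β b : ℝ} (hb : |b| ≤ β)
    (ξ : V) :
    ‖defPhiA E L ψ x ν b ξ‖ ≤ phiMajorant L C γ ρ ψ x ν β * (1 + ‖ξ‖ ^ (Module.finrank ℝ V + 1))⁻¹ ∧
    ‖defPhiDbA E L ψ x ν b ξ‖ ≤ phiMajorant L C γ ρ ψ x ν β * (1 + ‖ξ‖ ^
      (Module.finrank ℝ V + 1))⁻¹ ∧
    ‖defPhiDνA E L ψ x ν b ξ‖ ≤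
      phiMajorant L C γ ρ ψ x ν β * (1 + ‖ξ‖ ^ (Module.finrank ℝ V + 1))⁻¹ := by
  set D := Module.finrank ℝ V + 1 with hD
  set w : ℝ := (1 + ‖ξ‖ ^ D)⁻¹ with hw
  have hw0 : 0 ≤ w := by positivity
  have hβ : 0 ≤ β := (abs_nonneg b).trans hb
  -- the factors
  set e := ‖phaseE x ν b ξ‖ with he
  set m := ‖symMA E L ν b ξ‖ with hm
  set dm := ‖symDA E L ν b ξ‖ with hdm
  set q := ‖𝓕 (deform ψ ν b) ξ‖ with hq
  set dq := ‖𝓕 (deform (innerWeight ψ ν) ν b) ξ‖ with hdq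
  -- their bounds
  set Eβ := Real.exp (2 * π * β * ‖x‖) with hEβ
  set Mβ := (k : ℝ) * (C * Real.exp (γ * β)) with hMβ
  set DMβ := ((k : ℝ) * (C * Real.exp (γ * (β + 1)))) ^ 2 * ‖L ν‖ with hDMβ
  set Qβ := fourierMajorant ρ β ψ with hQβ
  set DQβ := fourierMajorant ρ β (innerWeight ψ ν) with hDQβ
  have he' : e ≤ Eβ := norm_phaseE_le hν hb ξ
  have hm' : m ≤ Mβ := by
    refine (hT.norm_symMA_le hC hν b ξ).trans ?_
    rw [hMβ]
    exact mul_le_mul_of_nonneg_left (mul_le_mul_of_nonneg_left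
      (Real.exp_le_exp.2 (mul_le_mul_of_nonneg_left hb hγ)) hC) (Nat.cast_nonneg k)
  have hdm' : dm ≤ DMβ := by
    refine (hT.norm_symDA_le hC hγ hν b ξ).trans ?_
    rw [hDMβ]
    refine mul_le_mul_of_nonneg_right (pow_le_pow_left₀ (by positivity) ?_ 2) (norm_nonneg _)
    exact mul_le_mul_of_nonneg_left (mul_le_mul_of_nonneg_left
      (Real.exp_le_exp.2 (mul_le_mul_of_nonneg_left (by linarith) hγ)) hC) (Nat.cast_nonneg k)
  have hq' : q ≤ Qβ * w := norm_fourier_deform_le_inv hψ hc hρ hsupp hν hb ξ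
  have hdq' : dq ≤ DQβ * w :=
    norm_fourier_deform_le_inv (contDiff_innerWeight hψ ν) (hasCompactSupport_innerWeight hc ν) hρ
      ((tsupport_innerWeight_subset ψ ν).trans hsupp) hν hb ξ
  have hQ0 : 0 ≤ Qβ := fourierMajorant_nonneg hβ ψ
  have hDQ0 : 0 ≤ DQβ := fourierMajorant_nonneg hβ (innerWeight ψ ν)
  have hx1 : ‖((2 * π * ⟪x, ν⟫ : ℝ) : ℂ)‖ ≤ 2 * π * ‖x‖ := by
    rw [Complex.norm_real, Real.norm_eq_abs, abs_mul, abs_of_pos Real.two_pi_pos]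
    refine mul_le_mul_of_nonneg_left ?_ Real.two_pi_pos.le
    calc |⟪x, ν⟫| ≤ ‖x‖ * ‖ν‖ := abs_real_inner_le_norm x ν
      _ ≤ ‖x‖ * 1 := mul_le_mul_of_nonneg_left hν (norm_nonneg _)
      _ = ‖x‖ := mul_one _
  have hx2 : ‖(2 * π * I * ⟪ν, x⟫ : ℂ)‖ ≤ 2 * π * ‖x‖ := by
    have : (2 * π * I * ⟪ν, x⟫ : ℂ) = ((2 * π * ⟪ν, x⟫ : ℝ) : ℂ) * I := by push_cast; ring
    rw [this, norm_mul, Complex.norm_I, mul_one, Complex.norm_real, Real.norm_eq_abs, abs_mul,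
      abs_of_pos Real.two_pi_pos]
    refine mul_le_mul_of_nonneg_left ?_ Real.two_pi_pos.le
    calc |⟪ν, x⟫| ≤ ‖ν‖ * ‖x‖ := abs_real_inner_le_norm ν x
      _ ≤ 1 * ‖x‖ := mul_le_mul_of_nonneg_right hν (norm_nonneg _)
      _ = ‖x‖ := one_mul _
  -- elementary products
  have hmul : ∀ {a a' c c' : ℝ}, 0 ≤ a → 0 ≤ c → a ≤ a' → c ≤ c' → a * c ≤ a' * c' :=
    fun ha hc haa hcc => mul_le_mul haa hcc hc (ha.trans haa)
  have hmq : ‖symMA E L ν b ξ *ᵥ 𝓕 (deform ψ ν b) ξ‖ ≤ Mβ * (Qβ * w) :=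
    (Matrix.linfty_opNorm_mulVec _ _).trans (hmul (norm_nonneg _) (norm_nonneg _) hm' hq')
  have hdmq : ‖symDA E L ν b ξ *ᵥ 𝓕 (deform ψ ν b) ξ‖ ≤ DMβ * (Qβ * w) :=
    (Matrix.linfty_opNorm_mulVec _ _).trans (hmul (norm_nonneg _) (norm_nonneg _) hdm' hq')
  have hmdq : ‖symMA E L ν b ξ *ᵥ 𝓕 (deform (innerWeight ψ ν) ν b) ξ‖ ≤ Mβ * (DQβ * w) :=
    (Matrix.linfty_opNorm_mulVec _ _).trans (hmul (norm_nonneg _) (norm_nonneg _) hm' hdq')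
  have hmdq' : ‖symMA E L ν b ξ *ᵥ 𝓕 (fun v => (-(2 * π * I * ⟪v, ν⟫)) • deform ψ ν b v) ξ‖ ≤
      Mβ * (DQβ * w) := by
    have heq : 𝓕 (fun v => (-(2 * π * I * ⟪v, ν⟫)) • deform ψ ν b v) ξ =
        (-I) • 𝓕 (deform (innerWeight ψ ν) ν b) ξ := by
      rw [fourier_deform_innerWeight_eq, smul_smul,
        show -I * I = 1 by rw [neg_mul, I_mul_I, neg_neg], one_smul]
    rw [heq, Matrix.mulVec_smul, norm_smul, norm_neg, Complex.norm_I, one_mul]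
    exact hmdq
  have hE0 : 0 ≤ Eβ := (Real.exp_pos _).le
  have hM0 : 0 ≤ Mβ := by rw [hMβ]; positivity
  -- the majorant, expanded
  have hK : phiMajorant L C γ ρ ψ x ν β = Eβ *
    ((1 + 2 * π * ‖x‖) * Mβ * Qβ + DMβ * Qβ + Mβ * DQβ) := by
    simp only [phiMajorant, hEβ, hMβ, hDMβ, hQβ, hDQβ]
  refine ⟨?_, ?_, ?_⟩
  · -- `Φ`
    rw [defPhiA, norm_smul, hK]
    calc e * ‖symMA E L ν b ξ *ᵥ 𝓕 (deform ψ ν b) ξ‖ ≤ Eβ * (Mβ * (Qβ * w)) :=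
          hmul (norm_nonneg _) (norm_nonneg _) he' hmq
      _ = Eβ * (1 * Mβ * Qβ) * w := by ring
      _ ≤ Eβ * ((1 + 2 * π * ‖x‖) * Mβ * Qβ + DMβ * Qβ + Mβ * DQβ) * w := by
          refine mul_le_mul_of_nonneg_right (mul_le_mul_of_nonneg_left ?_ hE0) hw0
          have h1 : (1 : ℝ) * Mβ * Qβ ≤ (1 + 2 * π * ‖x‖) * Mβ * Qβ := by
            gcongr; linarith [show 0 ≤ 2 * π * ‖x‖ by positivity]
          have h2 : 0 ≤ DMβ * Qβ := by positivity
          have h3 : 0 ≤ Mβ * DQβ := by positivity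
          linarith
  · -- `∂_b Φ`
    rw [defPhiDbA, hK]
    refine (norm_add_le _ _).trans ?_
    rw [norm_smul, norm_mul]
    have t1 : ‖((-(2 * π * ⟪x, ν⟫) : ℂ))‖ * e * ‖symMA E L ν b ξ *ᵥ 𝓕 (deform ψ ν b) ξ‖ ≤
        (2 * π * ‖x‖) * Eβ * (Mβ * (Qβ * w)) := by
      refine hmul (by positivity) (norm_nonneg _) (hmul (norm_nonneg _) (norm_nonneg _) ?_ he') hmq
      rw [norm_neg]
      exact_mod_cast hx1
    have t2 : ‖phaseE x ν b ξ • ((I • symDA E L ν b ξ) *ᵥ 𝓕 (deform ψ ν b) ξ +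
        symMA E L ν b ξ *ᵥ 𝓕 (deform (innerWeight ψ ν) ν b) ξ)‖ ≤
        Eβ * (DMβ * (Qβ * w) + Mβ * (DQβ * w)) := by
      rw [norm_smul]
      refine hmul (norm_nonneg _) (norm_nonneg _) he' ((norm_add_le _ _).trans (add_le_add ?_ hmdq))
      rw [Matrix.smul_mulVec, norm_smul, Complex.norm_I, one_mul]
      exact hdmq
    calc _ ≤ (2 * π * ‖x‖) * Eβ * (Mβ * (Qβ * w)) + Eβ * (DMβ * (Qβ * w) + Mβ * (DQβ * w)) :=
          add_le_add t1 t2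
      _ = Eβ * ((2 * π * ‖x‖) * Mβ * Qβ + DMβ * Qβ + Mβ * DQβ) * w := by ring
      _ ≤ Eβ * ((1 + 2 * π * ‖x‖) * Mβ * Qβ + DMβ * Qβ + Mβ * DQβ) * w := by
          refine mul_le_mul_of_nonneg_right (mul_le_mul_of_nonneg_left ?_ hE0) hw0
          have : (2 * π * ‖x‖) * Mβ * Qβ ≤ (1 + 2 * π * ‖x‖) * Mβ * Qβ := by
            gcongr; linarith
          linarith
  · -- `∂_ν Φ`
    rw [defPhiDνA, hK]
    refine (norm_add_le _ _).trans ?_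
    rw [norm_smul, norm_mul]
    have t1 : ‖(2 * π * I * ⟪ν, x⟫ : ℂ)‖ * e * ‖symMA E L ν b ξ *ᵥ 𝓕 (deform ψ ν b) ξ‖ ≤
        (2 * π * ‖x‖) * Eβ * (Mβ * (Qβ * w)) :=
      hmul (by positivity) (norm_nonneg _) (hmul (norm_nonneg _) (norm_nonneg _) hx2 he') hmq
    have t2 : ‖phaseE x ν b ξ • (symDA E L ν b ξ *ᵥ 𝓕 (deform ψ ν b) ξ +
        symMA E L ν b ξ *ᵥ 𝓕 (fun v => (-(2 * π * I * ⟪v, ν⟫)) • deform ψ ν b v) ξ)‖ ≤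
        Eβ * (DMβ * (Qβ * w) + Mβ * (DQβ * w)) := by
      rw [norm_smul]
      exact hmul (norm_nonneg _) (norm_nonneg _) he'
        ((norm_add_le _ _).trans (add_le_add hdmq hmdq'))
    calc _ ≤ (2 * π * ‖x‖) * Eβ * (Mβ * (Qβ * w)) + Eβ * (DMβ * (Qβ * w) + Mβ * (DQβ * w)) :=
          add_le_add t1 t2
      _ = Eβ * ((2 * π * ‖x‖) * Mβ * Qβ + DMβ * Qβ + Mβ * DQβ) * w := by ring
      _ ≤ Eβ * ((1 + 2 * π * ‖x‖) * Mβ * Qβ + DMβ * Qβ + Mβ * DQβ) * w := by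
          refine mul_le_mul_of_nonneg_right (mul_le_mul_of_nonneg_left ?_ hE0) hw0
          have : (2 * π * ‖x‖) * Mβ * Qβ ≤ (1 + 2 * π * ‖x‖) * Mβ * Qβ := by
            gcongr; linarith
          linarith

end Majorant

/-! ### The deformed integral `J(b) = ∫ Φ_b` -/

section Deformation

/-- Continuity of `ξ ↦ Φ_b(ξ)`. [folklore] -/
theorem continuous_defPhiA (E : 𝕄) (L : V →L[ℝ] 𝕄) {ψ : V → Fin k → ℂ} (hψ : ContDiff ℝ ∞ ψ)
    (hc : HasCompactSupport ψ) (x ν : V) (b : ℝ) : Continuous (defPhiA E L ψ x ν b) := by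
  unfold defPhiA phaseE symMA
  have h1 : Continuous fun ξ : V => Complex.exp (((2 * π * ⟪ξ, x⟫ : ℝ) : ℂ) * I) *
      ((Real.exp (-(2 * π * b * ⟪x, ν⟫)) : ℝ) : ℂ) :=
    ((Complex.continuous_exp.comp ((Complex.continuous_ofReal.comp
      (continuous_const.mul (continuous_id.inner continuous_const))).mul continuous_const))).mul
      continuous_const
  have h2 : Continuous fun ξ : V => NormedSpace.exp (E + L ξ + ((b : ℂ) * I) • L ν) :=
    NormedSpace.exp_continuous.comp ((continuous_const.add L.continuous).add continuous_const)
  have h3 := continuous_fourier_deform hψ hc ν b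
  exact h1.smul (((mulVecBilin (k := k)).continuous₂).comp (h2.prodMk h3))

/-- `J(b) = ∫ Φ_b(ξ) dξ`. [folklore] -/
def defJA (E : 𝕄) (L : V →L[ℝ] 𝕄) (ψ : V → Fin k → ℂ) (x ν : V) (b : ℝ) : Fin k → ℂ :=
  ∫ ξ, defPhiA E L ψ x ν b ξ

/-- `Φ_b` is integrable. [folklore] -/
theorem integrable_defPhiA (E : 𝕄) (L : V →L[ℝ] 𝕄) {C γ : ℝ} (hT : HasExpTypeA E L C γ)
    (hC : 0 ≤ C) (hγ : 0 ≤ γ)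
    {ψ : V → Fin k → ℂ} (hψ : ContDiff ℝ ∞ ψ) (hc : HasCompactSupport ψ) {ρ : ℝ} (hρ : 0 ≤ ρ)
    (hsupp : tsupport ψ ⊆ closedBall (0 : V) ρ) (x : V) {ν : V} (hν : ‖ν‖ ≤ 1) (b : ℝ) :
    Integrable (defPhiA E L ψ x ν b) := by
  have h1 := integrable_majorant (V := V) (phiMajorant L C γ ρ ψ x ν |b|)
  have h2 : AEStronglyMeasurable (defPhiA E L ψ x ν b) volume :=
    (continuous_defPhiA E L hψ hc x ν b).aestronglyMeasurable
  refine h1.mono' h2 (Eventually.of_forall fun ξ => ?_)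
  exact (norm_defPhiA_le hT hC hγ hψ hc hρ hsupp hν le_rfl ξ).1

/-- `∂_νΦ_b` is integrable. [folklore] -/
theorem integrable_defPhiDνA (E : 𝕄) (L : V →L[ℝ] 𝕄) {C γ : ℝ} (hT : HasExpTypeA E L C γ)
    (hC : 0 ≤ C) (hγ : 0 ≤ γ)
    {ψ : V → Fin k → ℂ} (hψ : ContDiff ℝ ∞ ψ) (hc : HasCompactSupport ψ) {ρ : ℝ} (hρ : 0 ≤ ρ)
    (hsupp : tsupport ψ ⊆ closedBall (0 : V) ρ) (x : V) {ν : V} (hν : ‖ν‖ ≤ 1) (b : ℝ) :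
    Integrable (defPhiDνA E L ψ x ν b) := by
  refine (integrable_majorant _).mono' ?_
    (Eventually.of_forall fun ξ => (norm_defPhiA_le hT hC hγ hψ hc hρ hsupp hν le_rfl ξ).2.2)
  -- measurability: `∂_νΦ_b` is the line derivative of the continuous `Φ_b`
  refine (aestronglyMeasurable_lineDeriv (𝕜 := ℝ) (v := ν) (μ := volume)
    (continuous_defPhiA E L hψ hc x ν b)).congr (ae_of_all _ fun ξ => ?_)
  exact (hasLineDerivAt_defPhiA E L hψ hc x ν ξ b).lineDeriv

/-- `∂_bΦ_b` is a.e.-strongly measurable in `ξ` (it is `i ∂_νΦ_b`). [folklore] -/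
theorem aestronglyMeasurable_defPhiDbA (E : 𝕄) (L : V →L[ℝ] 𝕄) {ψ : V → Fin k → ℂ}
    (hψ : ContDiff ℝ ∞ ψ)
    (hc : HasCompactSupport ψ) (x ν : V) (b : ℝ) : AEStronglyMeasurable
      (defPhiDbA E L ψ x ν b) volume := by
  have h : AEStronglyMeasurable (defPhiDνA E L ψ x ν b) volume := by
    refine (aestronglyMeasurable_lineDeriv (𝕜 := ℝ) (v := ν) (μ := volume)
      (continuous_defPhiA E L hψ hc x ν b)).congr (ae_of_all _ fun ξ => ?_)
    exact (hasLineDerivAt_defPhiA E L hψ hc x ν ξ b).lineDeriv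
  have hfun : defPhiDbA E L ψ x ν b = fun ξ => I • defPhiDνA E L ψ x ν b ξ :=
    funext fun ξ => defPhiDbA_eq E L ψ x ν ξ b
  rw [hfun]
  exact h.const_smul I

/-- **`J` is differentiable with `J'(b) = ∫ ∂_bΦ_b`** (differentiation under the integral sign,
dominated by the majorant on `|b| ≤ |b₀| + 1`). [folklore] -/
theorem hasDerivAt_defJA (E : 𝕄) (L : V →L[ℝ] 𝕄) {C γ : ℝ} (hT : HasExpTypeA E L C γ) (hC : 0 ≤ C)
    (hγ : 0 ≤ γ)
    {ψ : V → Fin k → ℂ} (hψ : ContDiff ℝ ∞ ψ) (hc : HasCompactSupport ψ) {ρ : ℝ} (hρ : 0 ≤ ρ)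
    (hsupp : tsupport ψ ⊆ closedBall (0 : V) ρ) (x : V) {ν : V} (hν : ‖ν‖ ≤ 1) (b₀ : ℝ) :
    HasDerivAt (defJA E L ψ x ν) (∫ ξ, defPhiDbA E L ψ x ν b₀ ξ) b₀ := by
  have hball : ∀ b ∈ ball b₀ 1, |b| ≤ |b₀| + 1 := fun b hb => by
    have : |b - b₀| < 1 := by simpa [Real.dist_eq] using mem_ball.1 hb
    have := abs_sub_abs_le_abs_sub b b₀
    linarith
  have key := hasDerivAt_integral_of_dominated_loc_of_deriv_le (μ := (volume : Measure V))
    (F := fun b ξ => defPhiA E L ψ x ν b ξ) (F' := fun b ξ => defPhiDbA E L ψ x ν b ξ) (x₀ := b₀)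
    (s := ball b₀ 1) (ball_mem_nhds b₀ one_pos)
    (Eventually.of_forall fun b => (continuous_defPhiA E L hψ hc x ν b).aestronglyMeasurable)
    (integrable_defPhiA E L hT hC hγ hψ hc hρ hsupp x hν b₀)
    (aestronglyMeasurable_defPhiDbA E L hψ hc x ν b₀)
    (Eventually.of_forall fun ξ b hb =>
      (norm_defPhiA_le hT hC hγ hψ hc hρ hsupp hν (hball b hb) ξ).2.1)
    (integrable_majorant _)
    (Eventually.of_forall fun ξ b _ => hasDerivAt_defPhiA_param E L hψ hc x ν ξ b)
  exact key.2

/-- **`∫ ∂_νΦ_b = 0`** (no boundary terms: integration by parts against the constant `1`).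
[folklore] -/
theorem integral_defPhiDνA_eq_zero (E : 𝕄) (L : V →L[ℝ] 𝕄) {C γ : ℝ} (hT : HasExpTypeA E L C γ)
    (hC : 0 ≤ C) (hγ : 0 ≤ γ)
    {ψ : V → Fin k → ℂ} (hψ : ContDiff ℝ ∞ ψ) (hc : HasCompactSupport ψ) {ρ : ℝ} (hρ : 0 ≤ ρ)
    (hsupp : tsupport ψ ⊆ closedBall (0 : V) ρ) (x : V) {ν : V} (hν : ‖ν‖ ≤ 1) (b : ℝ) :
    ∫ ξ, defPhiDνA E L ψ x ν b ξ = 0 := by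
  set B : (Fin k → ℂ) →L[ℝ] ℂ →L[ℝ] (Fin k → ℂ) := (ContinuousLinearMap.lsmul ℝ ℂ).flip with hB
  have hBapply : ∀ (u : Fin k → ℂ) (c : ℂ), B u c = c • u := fun u c => rfl
  have hf := integrable_defPhiA E L hT hC hγ hψ hc hρ hsupp x hν b
  have hf' := integrable_defPhiDνA E L hT hC hγ hψ hc hρ hsupp x hν b
  have h := integral_bilinear_hasLineDerivAt_right_eq_neg_left_of_integrable (μ :=
    (volume : Measure V))
    (f := defPhiA E L ψ x ν b) (f' := defPhiDνA E L ψ x ν b) (g := fun _ : V => (1 : ℂ))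
    (g' := fun _ => (0 : ℂ)) (v := ν) (B := B) ?_ ?_ ?_ ?_ ?_
  · simpa [hBapply] using h
  · simpa [hBapply] using hf'
  · simp [hBapply]
  · simpa [hBapply] using hf
  · intro ξ _; exact hasLineDerivAt_defPhiA E L hψ hc x ν ξ b
  · intro ξ _; exact hasDerivAt_const (0 : ℝ) (1 : ℂ)

/-- **`J` is constant**: `J(b) = J(0)`. [folklore] -/
theorem defJA_eq_defJA_zero (E : 𝕄) (L : V →L[ℝ] 𝕄) {C γ : ℝ} (hT : HasExpTypeA E L C γ)
    (hC : 0 ≤ C) (hγ : 0 ≤ γ)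
    {ψ : V → Fin k → ℂ} (hψ : ContDiff ℝ ∞ ψ) (hc : HasCompactSupport ψ) {ρ : ℝ} (hρ : 0 ≤ ρ)
    (hsupp : tsupport ψ ⊆ closedBall (0 : V) ρ) (x : V) {ν : V} (hν : ‖ν‖ ≤ 1) (b : ℝ) :
    defJA E L ψ x ν b = defJA E L ψ x ν 0 := by
  have hzero : ∀ b₀, HasDerivAt (defJA E L ψ x ν) 0 b₀ := by
    intro b₀
    have h := hasDerivAt_defJA E L hT hC hγ hψ hc hρ hsupp x hν b₀
    have hint : ∫ ξ, defPhiDbA E L ψ x ν b₀ ξ = 0 := by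
      have hfun : defPhiDbA E L ψ x ν b₀ = fun ξ => I • defPhiDνA E L ψ x ν b₀ ξ :=
        funext fun ξ => defPhiDbA_eq E L ψ x ν ξ b₀
      rw [hfun, integral_smul, integral_defPhiDνA_eq_zero E L hT hC hγ hψ hc hρ hsupp x hν b₀,
        smul_zero]
    rwa [hint] at h
  exact is_const_of_deriv_eq_zero (fun b₀ => (hzero b₀).differentiableAt)
    (fun b₀ => (hzero b₀).deriv) b 0

/-- **Exponential decay of the integrand in `b`**:
`‖J(b)‖ ≤ e^{-2πb⟪x,ν⟫} · kC e^{γ|b|} · (1 + 4^D(D+1)) (1 + 2π|b|)^D e^{2πρ|b|} (Σ∫‖Dʲψ‖) I_D`.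
[folklore] -/
theorem norm_defJA_le (E : 𝕄) (L : V →L[ℝ] 𝕄) {C γ : ℝ} (hT : HasExpTypeA E L C γ) (hC : 0 ≤ C)
    {ψ : V → Fin k → ℂ} (hψ : ContDiff ℝ ∞ ψ) (hc : HasCompactSupport ψ) {ρ : ℝ}
    (hsupp : tsupport ψ ⊆ closedBall (0 : V) ρ) (x : V) {ν : V} (hν : ‖ν‖ ≤ 1) (b : ℝ) :
    ‖defJA E L ψ x ν b‖ ≤
      Real.exp (-(2 * π * b * ⟪x, ν⟫)) * (k * (C * Real.exp (γ * |b|))) *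
        ((1 + 4 ^ (Module.finrank ℝ V + 1) * ((Module.finrank ℝ V + 1 : ℕ) + 1)) *
          (1 + 2 * π * |b|) ^ (Module.finrank ℝ V + 1) * Real.exp (2 * π * ρ * |b|) *
          derivIntSum (Module.finrank ℝ V + 1) ψ *
          ∫ w : V, (1 + ‖w‖ ^ (Module.finrank ℝ V + 1))⁻¹) := by
  set c : ℝ := Real.exp (-(2 * π * b * ⟪x, ν⟫)) * (k * (C * Real.exp (γ * |b|))) with hcdef
  have hc0 : 0 ≤ c := by positivity
  -- pointwise bound `‖Φ_b(ξ)‖ ≤ c ‖𝓕ψ_b(ξ)‖`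
  have hpt : ∀ ξ, ‖defPhiA E L ψ x ν b ξ‖ ≤ c * ‖𝓕 (deform ψ ν b) ξ‖ := by
    intro ξ
    rw [defPhiA, norm_smul, norm_phaseE, hcdef]
    have h1 : ‖symMA E L ν b ξ *ᵥ 𝓕 (deform ψ ν b) ξ‖ ≤
        (k * (C * Real.exp (γ * |b|))) * ‖𝓕 (deform ψ ν b) ξ‖ :=
      (Matrix.linfty_opNorm_mulVec _ _).trans
        (mul_le_mul_of_nonneg_right (hT.norm_symMA_le hC hν b ξ) (norm_nonneg _))
    calc Real.exp (-(2 * π * b * ⟪x, ν⟫)) * ‖symMA E L ν b ξ *ᵥ 𝓕 (deform ψ ν b) ξ‖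
        ≤ Real.exp (-(2 * π * b * ⟪x, ν⟫)) * ((k * (C * Real.exp (γ * |b|))) *
            ‖𝓕 (deform ψ ν b) ξ‖) := mul_le_mul_of_nonneg_left h1 (Real.exp_pos _).le
      _ = _ := (mul_assoc _ _ _).symm
  -- integrability of `‖𝓕ψ_b‖` from the decay bound
  have hdec : ∀ ξ, ‖𝓕 (deform ψ ν b) ξ‖ ≤
      fourierMajorant ρ |b| ψ * (1 + ‖ξ‖ ^ (Module.finrank ℝ V + 1))⁻¹ := fun ξ => by
    rcases le_or_gt 0 ρ with hρ | hρ
    · exact norm_fourier_deform_le_inv hψ hc hρ hsupp hν le_rfl ξ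
    · -- `ρ < 0`: the support is empty, `ψ = 0`
      have hψ0 : deform ψ ν b = 0 := by
        funext y
        have : y ∉ tsupport ψ := fun hy => by
          have := hsupp hy
          rw [mem_closedBall, dist_zero_right] at this
          linarith [norm_nonneg y]
        simp [deform, image_eq_zero_of_notMem_tsupport this]
      rw [hψ0]
      have : 𝓕 (0 : V → Fin k → ℂ) ξ = 0 := by simp [Real.fourier_eq, Circle.smul_def]
      rw [this, norm_zero]
      exact mul_nonneg (fourierMajorant_nonneg (abs_nonneg b) ψ) (by positivity)
  have hint : Integrable fun ξ => ‖𝓕 (deform ψ ν b) ξ‖ :=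
    (integrable_majorant _).mono' (continuous_fourier_deform hψ hc ν b).norm.aestronglyMeasurable
      (Eventually.of_forall fun ξ => by rw [Real.norm_of_nonneg (norm_nonneg _)]; exact hdec ξ)
  calc ‖defJA E L ψ x ν b‖ ≤ ∫ ξ, ‖defPhiA E L ψ x ν b ξ‖ := norm_integral_le_integral_norm _
    _ ≤ ∫ ξ, c * ‖𝓕 (deform ψ ν b) ξ‖ :=
        integral_mono_of_nonneg (Eventually.of_forall fun ξ => norm_nonneg _) (hint.const_mul c)
          (Eventually.of_forall hpt)
    _ = c * ∫ ξ, ‖𝓕 (deform ψ ν b) ξ‖ := integral_const_mul _ _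
    _ ≤ c * _ := mul_le_mul_of_nonneg_left (integral_norm_fourier_deform_le hψ hc hsupp hν b) hc0

/-- **Paley–Wiener by deformation for affine pencils (support of multiplier outputs for symbols
`exp(E + Lξ)` of exponential type).** Let `E : 𝕄`, `L : V →L[ℝ] 𝕄` and suppose the deformed symbols
`exp(θE + Lξ + (ib)Lν)`, `0 ≤ θ ≤ 1`, are entrywise bounded by `C e^{γ|b|}` for all frequencies
`ξ`, unit directions `ν` and real `b`. Then for every `ψ ∈ C_c^∞(V; ℂᵏ)` supported in `B̄(0, ρ)`,
the multiplier output `exp(E + L·)(D)ψ = 𝓕⁻¹[exp(E + Lξ) 𝓕ψ(ξ)]` vanishes at every `x` with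
`‖x‖ > ρ + γ/(2π)`. (Proof: `J(b) = ∫ E_b M_b 𝓕ψ_b` is independent of `b` by Cauchy–Riemann and
integration by parts, equals the output at `b = 0`, and tends to `0` as `b → +∞` along
`ν = x/‖x‖`.) This is the shift-of-contour argument of [Hörmander, ALPDO II, Thm 12.5.1] with the
lower-order term carried along. [cite: Rauch1986, Proof of Theorem p. 482] -/
theorem multiplierOp_expAffine_apply_eq_zero {E : 𝕄} {L : V →L[ℝ] 𝕄} {C γ : ℝ}
    (hT : HasExpTypeA E L C γ)
    (hC : 0 ≤ C) (hγ : 0 ≤ γ) {ψ : V → Fin k → ℂ} (hψ : ContDiff ℝ ∞ ψ)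
    (hc : HasCompactSupport ψ) {ρ : ℝ} (hρ : 0 ≤ ρ) (hsupp : tsupport ψ ⊆ closedBall (0 : V) ρ)
    {x : V} (hx : ρ + γ / (2 * π) < ‖x‖) :
    multiplierOp (fun ξ => NormedSpace.exp (E + L ξ)) ψ x = 0 := by
  have h2π : 0 < 2 * π := Real.two_pi_pos
  have hxpos : 0 < ‖x‖ := lt_of_le_of_lt (by positivity) hx
  -- the direction
  set ν : V := ‖x‖⁻¹ • x with hν
  have hνn : ‖ν‖ = 1 := by
    rw [hν, norm_smul, norm_inv, norm_norm, inv_mul_cancel₀ hxpos.ne']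
  have hν1 : ‖ν‖ ≤ 1 := hνn.le
  have hxν : ⟪x, ν⟫ = ‖x‖ := by
    rw [hν, real_inner_smul_right, real_inner_self_eq_norm_sq]
    field_simp
  -- `J(0)` is the multiplier output at `x`
  have hJ0 : defJA E L ψ x ν 0 = multiplierOp (fun ξ => NormedSpace.exp (E + L ξ)) ψ x := by
    rw [defJA, multiplierOp_apply, Real.fourierInv_eq']
    refine integral_congr_ae (Eventually.of_forall fun ξ => ?_)
    exact defPhiA_zero E L ψ x ν ξ
  rw [← hJ0]
  -- the decay rate
  set δ : ℝ := 2 * π * ‖x‖ - γ - 2 * π * ρ with hδ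
  have hδ0 : 0 < δ := by
    have : γ / (2 * π) * (2 * π) = γ := div_mul_cancel₀ γ h2π.ne'
    nlinarith
  -- the constant in front
  set D := Module.finrank ℝ V + 1 with hD
  set A : ℝ := (k * C) * ((1 + 4 ^ D * ((D : ℕ) + 1 : ℝ)) * derivIntSum D ψ *
    ∫ w : V, (1 + ‖w‖ ^ D)⁻¹) with hA
  -- `‖J(0)‖ ≤ A (1 + 2πb)^D e^{-δ b}` for `b ≥ 0`
  have hbound : ∀ b : ℝ, 0 ≤ b →
      ‖defJA E L ψ x ν 0‖ ≤ A * ((1 + 2 * π * b) ^ D * Real.exp (-(δ * b))) := by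
    intro b hb
    rw [← defJA_eq_defJA_zero E L hT hC hγ hψ hc hρ hsupp x hν1 b]
    refine (norm_defJA_le E L hT hC hψ hc hsupp x hν1 b).trans (le_of_eq ?_)
    rw [abs_of_nonneg hb, hxν]
    have hexp : Real.exp (-(2 * π * b * ‖x‖)) * Real.exp (γ * b) * Real.exp (2 * π * ρ * b) =
        Real.exp (-(δ * b)) := by
      rw [← Real.exp_add, ← Real.exp_add, hδ]; congr 1; ring
    rw [← hexp, hA]
    ring
  -- let `b → +∞`
  have hlim : Tendsto (fun b : ℝ => A * ((1 + 2 * π * b) ^ D * Real.exp (-(δ * b)))) atTop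
      (𝓝 0) := by
    simpa using (tendsto_pow_mul_exp_neg_mul hδ0 D).const_mul A
  have hle : ‖defJA E L ψ x ν 0‖ ≤ 0 :=
    le_of_tendsto_of_tendsto tendsto_const_nhds hlim
      ((Filter.eventually_ge_atTop (0 : ℝ)).mono fun b hb => hbound b hb)
  exact norm_le_zero_iff.1 hle

/-- **Paley–Wiener by deformation for affine pencils, general centre**: if `ψ` is supported in
`B̄(x₀, r)` then `exp(E + L·)(D)ψ` vanishes at every `x` with `‖x - x₀‖ > r + γ/(2π)`.
[cite: Rauch1986, Proof of Theorem p. 482] -/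
theorem multiplierOp_expAffine_apply_eq_zero_of_dist {E : 𝕄} {L : V →L[ℝ] 𝕄} {C γ : ℝ}
    (hT : HasExpTypeA E L C γ) (hC : 0 ≤ C) (hγ : 0 ≤ γ) {ψ : V → Fin k → ℂ}
    (hψ : ContDiff ℝ ∞ ψ) (hc : HasCompactSupport ψ) {x₀ : V} {r : ℝ} (hr : 0 ≤ r)
    (hsupp : tsupport ψ ⊆ closedBall x₀ r) {x : V} (hx : r + γ / (2 * π) < ‖x - x₀‖) :
    multiplierOp (fun ξ => NormedSpace.exp (E + L ξ)) ψ x = 0 := by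
  set ψ₀ : V → Fin k → ℂ := ψ ∘ fun v => v + x₀ with hψ₀
  have hψ₀d : ContDiff ℝ ∞ ψ₀ := hψ.comp ((contDiff_id).add contDiff_const)
  have hψ₀c : HasCompactSupport ψ₀ := hc.comp_homeomorph (Homeomorph.addRight x₀)
  have hψ₀s : tsupport ψ₀ ⊆ closedBall (0 : V) r := tsupport_comp_add_subset hsupp
  have hback : ψ = ψ₀ ∘ fun v => v + (-x₀) := by
    funext v; simp [hψ₀]
  rw [hback, multiplierOp_comp_add_right, ← sub_eq_add_neg]
  exact multiplierOp_expAffine_apply_eq_zero hT hC hγ hψ₀d hψ₀c hr hψ₀s hx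

end Deformation

end Literature.Analysis.Fourier

end
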